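import Summits.CriticalPhenomena.PercolationContinuityZ3.Theorems.PercNearOneGluingNoHeavyLowerTailSahiGoodAxisFalse
import Mathlib.Tactic.Linarith
import Mathlib.Tactic.NormNum
import Mathlib.Tactic.FinCases
import HarnessLib

/-!
# `NoHeavyLowerTail` (crux stmt-CriticalPhenomena-4575): the "good axis" chord criterion fails even at the UNIFORM measure —
# an `S₃`-symmetric triple of nine-edge graph events on six coins with negative sectional chord defect along EVERY axis at `q ≡ 1/2`

Support file (cell `prim-master-conj`, generation 39; `--supports stmt-CriticalPhenomena-4575`).  No `sorry`, no named facts,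
standard axioms; a kernel-checked finite computation.

CONTEXT.  `SahiGoodAxis.GoodAxis` ("along some axis `E_3` is at least the `q`-average of its two sectional values") was refuted by the
doubled star at bias `3/5` (`SahiGoodAxisFalse.not_goodAxis`), a measure chosen off the census grids; the censuses at `q ≡ 1/2` had found
nothing.  The present file settles the natural follow-up question of the master-conjecture line (POINTWISE §40, "is there a good axis at the
uniform measure, where `2E_3(U) ≥ E_3(U^{a←0}) + E_3(U^{a←1})` would give Kahn's `C_3` at `p = 1/2` by induction?"): NO.

THE STATEMENT REFUTED.  `GoodAxisHalf`: for every triple of increasing events on a finite cube and every nonempty determining set `S`, some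
`a ∈ S` has `½Φ_a(1) + ½Φ_a(0) ≤ Φ_a(½)` for the fibre cubic `Φ_a = cubicE3` of the UNIFORM parameter vector `q ≡ 1/2` — i.e. `GoodAxis`
specialised to the uniform measure (`goodAxisHalf_of_goodAxis`).  `not_goodAxisHalf : ¬ GoodAxisHalf` (so this triple is also a second, independent witness for the tree's
`SahiGoodAxisFalse.not_goodAxis`, via `goodAxisHalf_of_goodAxis`).

THE WITNESS (found by a hill-climbing adversary of this seat; exact rational verification `code-g39/check_cex.py`).  `ι = Fin 6`; write `ab` for
the generator `x_a x_b`.  The three events are the up-sets generated by nine "edges" each,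
  `F = ⟨01,02,12,13,23,14,24,15,25⟩`,  `G = ⟨01,02,03,04,05,15,25,35,45⟩`,  `H = ⟨03,13,23,04,14,24,34,35,45⟩`
(an orbit of the coordinate permutation `(0 3)(1 4)(2 5)`-type symmetries; `μ(F) = μ(G) = μ(H) = 23/32`), `S` = all six coordinates.
Counts over the `64` points: singles `46`, pairs `36`, triple `27`, whence `64³·E_3 = 2·64²·27 + 46³ − 64·3·46·36 = 568`, `E_3 = 71/32768`.
Along every axis `a` the `1`-section triple has `E_3 = 0` exactly (`Φ_a(1) = 0`; face counts `(24,24,31)`, pairs `(18,24,24)`, triple `18` up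
to order) and the `0`-section has `Φ_a(0) = 156/32768 = 39/8192` (face counts `(22,22,15)`, pairs `(18,12,12)`, triple `9`); hence
`½Φ_a(1) + ½Φ_a(0) = 78/32768 > 71/32768 = Φ_a(½)` for ALL six `a`: the sectional defect `2E_3 − Φ_a(0) − Φ_a(1)` is `−7/16384` on every axis.
As for the doubled star, the top facets vanish while the bulk is positive — the mechanism by which a chord (an average) fails although the
slice MINIMUM principle (`…SahiSliceMinimum`) is respected with room (`min = 0 ≤ E_3`).

METHOD (as in `…SahiGoodAxisFalse`, simpler because all weights are equal): expectations at `q ≡ 1/2` are `(1/64)·Σ_{j<64}`, on the faces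
`x_a = 1`, `x_a = 0` they are `(1/32)·Σ` over the codes with bit `a` set / clear; the counts are kernel computations (`decide`) stated uniformly in
`a : Fin 6`.  HONEST FRAMING: a structural no-go for one induction scheme at the uniform measure; Kahn's `C_3` / `MasterFamilyNonneg 3`
remain OPEN. [this work]
-/

noncomputable section

open scoped Classical

namespace Summit.CriticalPhenomena.PercolationContinuityZ3.Theorems

namespace SahiUniformGoodAxisFalse

open Finset Function Literature.Combinatorics.Sahi2008
open Literature.Probability.Percolation (DeterminedBy determinedBy_iff)
open Literature.Probability.Percolation.DecisionTree (ind ind_of_mem ind_of_not_mem)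
open SahiC3Cube (pt)
open SahiGoodAxis (GoodAxis)
open SahiCoordinateTwoThirdsFalse (ind_eq_ite)
open SahiGoodAxisFalse (mem_pt_iff determinedBy_univ')

/-! ### 1. The statement refuted and the instance -/

/-- The bias `1/2` as a point of the unit interval. [this work] -/
def half : unitInterval := ⟨1 / 2, by norm_num, by norm_num⟩

/-- `(half : ℝ) = 1/2`. [this work] -/
theorem coe_half : ((half : unitInterval) : ℝ) = 1 / 2 := rfl

/-- **`GoodAxisHalf`** — `SahiGoodAxis.GoodAxis` specialised to the UNIFORM measure: for every triple of increasing events and every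
nonempty determining set `S`, some `a ∈ S` satisfies the chord inequality `½Φ_a(1) + ½Φ_a(0) ≤ Φ_a(½)` for the fibre cubic of `q ≡ 1/2`.
Refuted below (`not_goodAxisHalf`). [this work] [status: refuted in this file; kept as a tagged statement so that the refutation
has a named target, as `SahiSliceMinimum.UniformSliceAxis`] -/
@[conjecture] def GoodAxisHalf : Prop :=
  ∀ (κ : Type) [Fintype κ] (U : Fin 3 → Set (Set κ)), (∀ i, IsUpperSet (U i)) →
    ∀ S : Finset κ, S.Nonempty → (∀ i, DeterminedBy (U i) (↑S : Set κ)) →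
      ∃ a ∈ S, ((half : unitInterval) : ℝ) * cubicE3 (fun _ : κ => half) a (ind (U 0)) (ind (U 1)) (ind (U 2)) 1
          + (1 - ((half : unitInterval) : ℝ)) * cubicE3 (fun _ : κ => half) a (ind (U 0)) (ind (U 1)) (ind (U 2)) 0
        ≤ cubicE3 (fun _ : κ => half) a (ind (U 0)) (ind (U 1)) (ind (U 2)) ((half : unitInterval) : ℝ)

/-- `GoodAxis` implies its uniform-measure specialisation. [this work] -/
theorem goodAxisHalf_of_goodAxis (h : GoodAxis) : GoodAxisHalf :=
  fun κ _ U hU S hS hdet => h κ (fun _ => half) U hU S hS hdet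

/-- The edge event `x_a ∧ x_b` (the principal up-set of `{a, b}`). [this work] -/
def edge (a b : Fin 6) : Set (Set (Fin 6)) := {ω | a ∈ ω ∧ b ∈ ω}

/-- `F = ⟨01,02,12,13,23,14,24,15,25⟩`. [this work] -/
def ugF : Set (Set (Fin 6)) :=
  {ω | ω ∈ edge 0 1 ∨ ω ∈ edge 0 2 ∨ ω ∈ edge 1 2 ∨ ω ∈ edge 1 3 ∨ ω ∈ edge 2 3 ∨ ω ∈ edge 1 4 ∨ ω ∈ edge 2 4 ∨ ω ∈ edge 1 5 ∨ ω ∈ edge 2 5}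

/-- `G = ⟨01,02,03,04,05,15,25,35,45⟩`. [this work] -/
def ugG : Set (Set (Fin 6)) :=
  {ω | ω ∈ edge 0 1 ∨ ω ∈ edge 0 2 ∨ ω ∈ edge 0 3 ∨ ω ∈ edge 0 4 ∨ ω ∈ edge 0 5 ∨ ω ∈ edge 1 5 ∨ ω ∈ edge 2 5 ∨ ω ∈ edge 3 5 ∨ ω ∈ edge 4 5}

/-- `H = ⟨03,13,23,04,14,24,34,35,45⟩`. [this work] -/
def ugH : Set (Set (Fin 6)) :=
  {ω | ω ∈ edge 0 3 ∨ ω ∈ edge 1 3 ∨ ω ∈ edge 2 3 ∨ ω ∈ edge 0 4 ∨ ω ∈ edge 1 4 ∨ ω ∈ edge 2 4 ∨ ω ∈ edge 3 4 ∨ ω ∈ edge 3 5 ∨ ω ∈ edge 4 5}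

/-- The triple `U = (F, G, H)`. [this work] -/
def ugU : Fin 3 → Set (Set (Fin 6)) := ![ugF, ugG, ugH]

/-- The constant parameter vector `q ≡ 1/2` on `Fin 6`. [this work] -/
def q12 : Fin 6 → unitInterval := fun _ => half

/-- `(q a : ℝ) = 1/2`. [this work] -/
theorem coe_q12 (a : Fin 6) : ((q12 a : unitInterval) : ℝ) = 1 / 2 := rfl

/-- An edge event is an up-set (clause form). [folklore] -/
theorem edge_mono {ω ω' : Set (Fin 6)} (hle : ω ≤ ω') {a b : Fin 6} (h : ω ∈ edge a b) : ω' ∈ edge a b :=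
  ⟨hle h.1, hle h.2⟩

/-- A nine-fold disjunction is monotone under clause-wise implications. [folklore] -/
theorem or9_mono {P₁ P₂ P₃ P₄ P₅ P₆ P₇ P₈ P₉ Q₁ Q₂ Q₃ Q₄ Q₅ Q₆ Q₇ Q₈ Q₉ : Prop}
    (h₁ : P₁ → Q₁) (h₂ : P₂ → Q₂) (h₃ : P₃ → Q₃) (h₄ : P₄ → Q₄) (h₅ : P₅ → Q₅) (h₆ : P₆ → Q₆) (h₇ : P₇ → Q₇)
    (h₈ : P₈ → Q₈) (h₉ : P₉ → Q₉) (h : P₁ ∨ P₂ ∨ P₃ ∨ P₄ ∨ P₅ ∨ P₆ ∨ P₇ ∨ P₈ ∨ P₉) :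
    Q₁ ∨ Q₂ ∨ Q₃ ∨ Q₄ ∨ Q₅ ∨ Q₆ ∨ Q₇ ∨ Q₈ ∨ Q₉ :=
  h.imp h₁ (fun h => h.imp h₂ (fun h => h.imp h₃ (fun h => h.imp h₄ (fun h => h.imp h₅ (fun h => h.imp h₆
    (fun h => h.imp h₇ (fun h => h.imp h₈ h₉)))))))

/-- `F` is an up-set. [this work] -/
theorem isUpperSet_ugF : IsUpperSet ugF := fun _ _ hle hω =>
  or9_mono (edge_mono hle) (edge_mono hle) (edge_mono hle) (edge_mono hle) (edge_mono hle) (edge_mono hle)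
    (edge_mono hle) (edge_mono hle) (edge_mono hle) hω

/-- `G` is an up-set. [this work] -/
theorem isUpperSet_ugG : IsUpperSet ugG := fun _ _ hle hω =>
  or9_mono (edge_mono hle) (edge_mono hle) (edge_mono hle) (edge_mono hle) (edge_mono hle) (edge_mono hle)
    (edge_mono hle) (edge_mono hle) (edge_mono hle) hω

/-- `H` is an up-set. [this work] -/
theorem isUpperSet_ugH : IsUpperSet ugH := fun _ _ hle hω =>
  or9_mono (edge_mono hle) (edge_mono hle) (edge_mono hle) (edge_mono hle) (edge_mono hle) (edge_mono hle)
    (edge_mono hle) (edge_mono hle) (edge_mono hle) hω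

/-- All three events are up-sets. [this work] -/
theorem isUpperSet_ugU : ∀ j, IsUpperSet (ugU j) := by
  intro j; fin_cases j
  · exact isUpperSet_ugF
  · exact isUpperSet_ugG
  · exact isUpperSet_ugH

/-! ### 2. Uniform weights: expectations as plain sums over the 64 codes -/

/-- Each factor of the product weight at `q ≡ 1/2` is `1/2`. [this work] -/
theorem factor_eq (i : Fin 6) (j : ℕ) :
    (if i ∈ pt 6 j then ((q12 i : unitInterval) : ℝ) else 1 - ((q12 i : unitInterval) : ℝ)) = 1 / 2 := by
  rw [coe_q12]; split_ifs <;> norm_num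

/-- The uniform weight of a coded point is `1/64`. [this work] -/
theorem weight_q12 (j : ℕ) : bernoulliWeight q12 (pt 6 j) = 1 / 64 := by
  show (∏ i : Fin 6, if i ∈ pt 6 j then ((q12 i : unitInterval) : ℝ) else 1 - ((q12 i : unitInterval) : ℝ)) = _
  rw [Finset.prod_congr rfl fun i _ => factor_eq i j, Finset.prod_const, Finset.card_univ, Fintype.card_fin]
  norm_num

/-- The weight of `q[a ↦ 1]`: `1/32` on the face `x_a = 1`, `0` off it. [this work] -/
theorem weight_top (a : Fin 6) (j : ℕ) :
    bernoulliWeight (update q12 a 1) (pt 6 j) = if j.testBit a = true then (1 / 32 : ℝ) else 0 := by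
  show (∏ i : Fin 6, if i ∈ pt 6 j then ((update q12 a 1 i : unitInterval) : ℝ)
      else 1 - ((update q12 a 1 i : unitInterval) : ℝ)) = _
  rw [← Finset.mul_prod_erase Finset.univ _ (Finset.mem_univ a)]
  have h : ∀ i ∈ Finset.univ.erase a, (if i ∈ pt 6 j then ((update q12 a 1 i : unitInterval) : ℝ)
      else 1 - ((update q12 a 1 i : unitInterval) : ℝ)) = 1 / 2 := by
    intro i hi
    rw [update_of_ne (Finset.ne_of_mem_erase hi)]
    exact factor_eq i j
  rw [Finset.prod_congr rfl h, Finset.prod_const, Finset.card_erase_of_mem (Finset.mem_univ _), Finset.card_univ,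
    Fintype.card_fin, update_self, Set.Icc.coe_one]
  by_cases hb : j.testBit a = true
  · rw [if_pos ((mem_pt_iff a j).2 hb), if_pos hb]; norm_num
  · rw [if_neg (fun h => hb ((mem_pt_iff a j).1 h)), if_neg hb]; norm_num

/-- The weight of `q[a ↦ 0]`: `1/32` on the face `x_a = 0`, `0` off it. [this work] -/
theorem weight_bot (a : Fin 6) (j : ℕ) :
    bernoulliWeight (update q12 a 0) (pt 6 j) = if j.testBit a = true then 0 else (1 / 32 : ℝ) := by
  show (∏ i : Fin 6, if i ∈ pt 6 j then ((update q12 a 0 i : unitInterval) : ℝ)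
      else 1 - ((update q12 a 0 i : unitInterval) : ℝ)) = _
  rw [← Finset.mul_prod_erase Finset.univ _ (Finset.mem_univ a)]
  have h : ∀ i ∈ Finset.univ.erase a, (if i ∈ pt 6 j then ((update q12 a 0 i : unitInterval) : ℝ)
      else 1 - ((update q12 a 0 i : unitInterval) : ℝ)) = 1 / 2 := by
    intro i hi
    rw [update_of_ne (Finset.ne_of_mem_erase hi)]
    exact factor_eq i j
  rw [Finset.prod_congr rfl h, Finset.prod_const, Finset.card_erase_of_mem (Finset.mem_univ _), Finset.card_univ,
    Fintype.card_fin, update_self, Set.Icc.coe_zero]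
  by_cases hb : j.testBit a = true
  · rw [if_pos ((mem_pt_iff a j).2 hb), if_pos hb]; norm_num
  · rw [if_neg (fun h => hb ((mem_pt_iff a j).1 h)), if_neg hb]; norm_num

/-- Expectation at `q ≡ 1/2` as a plain sum over the codes. [this work] -/
theorem ex_q12 (F : Set (Fin 6) → ℝ) :
    ex (bernoulliWeight q12) F = (1 / 64) * ∑ j ∈ Finset.range 64, F (pt 6 j) := by
  rw [ex_def, SahiTransportJR.sum_eq_sum_range (m := 6) (fun x => bernoulliWeight q12 x * F x), Finset.mul_sum]
  refine Finset.sum_congr (by norm_num) fun j _ => ?_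
  rw [weight_q12]

/-- Expectation under `q[a ↦ 1]` as a plain sum over the codes of the face `x_a = 1`. [this work] -/
theorem ex_top (a : Fin 6) (F : Set (Fin 6) → ℝ) :
    ex (bernoulliWeight (update q12 a 1)) F =
      (1 / 32) * ∑ j ∈ Finset.range 64, (if j.testBit a = true then F (pt 6 j) else 0) := by
  rw [ex_def, SahiTransportJR.sum_eq_sum_range (m := 6) (fun x => bernoulliWeight (update q12 a 1) x * F x), Finset.mul_sum]
  refine Finset.sum_congr (by norm_num) fun j _ => ?_
  rw [weight_top]; split_ifs <;> ring

/-- Expectation under `q[a ↦ 0]` as a plain sum over the codes of the face `x_a = 0`. [this work] -/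
theorem ex_bot (a : Fin 6) (F : Set (Fin 6) → ℝ) :
    ex (bernoulliWeight (update q12 a 0)) F =
      (1 / 32) * ∑ j ∈ Finset.range 64, (if j.testBit a = true then 0 else F (pt 6 j)) := by
  rw [ex_def, SahiTransportJR.sum_eq_sum_range (m := 6) (fun x => bernoulliWeight (update q12 a 0) x * F x), Finset.mul_sum]
  refine Finset.sum_congr (by norm_num) fun j _ => ?_
  rw [weight_bot]; split_ifs <;> ring

/-! ### 3. Membership of the coded points: Boolean predicates -/

/-- Boolean edge test. [this work] -/
def be (a b : ℕ) (j : ℕ) : Bool := j.testBit a && j.testBit b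

/-- Bits of `F`. [this work] -/
def bF (j : ℕ) : Bool := be 0 1 j || be 0 2 j || be 1 2 j || be 1 3 j || be 2 3 j || be 1 4 j || be 2 4 j || be 1 5 j || be 2 5 j

/-- Bits of `G`. [this work] -/
def bG (j : ℕ) : Bool := be 0 1 j || be 0 2 j || be 0 3 j || be 0 4 j || be 0 5 j || be 1 5 j || be 2 5 j || be 3 5 j || be 4 5 j

/-- Bits of `H`. [this work] -/
def bH (j : ℕ) : Bool := be 0 3 j || be 1 3 j || be 2 3 j || be 0 4 j || be 1 4 j || be 2 4 j || be 3 4 j || be 3 5 j || be 4 5 j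

/-- Membership of a coded point in `F`. [this work] -/
theorem mem_ugF (j : ℕ) : pt 6 j ∈ ugF ↔ bF j = true := by
  simp [ugF, edge, pt, bF, be, or_assoc]

/-- Membership of a coded point in `G`. [this work] -/
theorem mem_ugG (j : ℕ) : pt 6 j ∈ ugG ↔ bG j = true := by
  simp [ugG, edge, pt, bG, be, or_assoc]

/-- Membership of a coded point in `H`. [this work] -/
theorem mem_ugH (j : ℕ) : pt 6 j ∈ ugH ↔ bH j = true := by
  simp [ugH, edge, pt, bH, be, or_assoc]

/-! ### 4. Counts as natural numbers and the kernel computations -/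

/-- Bulk count `#{j < 64 : c}`. [this work] -/
def SF (c : ℕ → Bool) : ℕ := ∑ j ∈ Finset.range 64, if c j = true then 1 else 0

/-- Face-`1` count along axis `a`. [this work] -/
def ST (a : ℕ) (c : ℕ → Bool) : ℕ := ∑ j ∈ Finset.range 64, if (j.testBit a && c j) = true then 1 else 0

/-- Face-`0` count along axis `a`. [this work] -/
def SB (a : ℕ) (c : ℕ → Bool) : ℕ := ∑ j ∈ Finset.range 64, if (!j.testBit a && c j) = true then 1 else 0

/-- The bulk indicator sum in `ℝ` is the cast of `SF c`. [this work] -/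
theorem sum_full_cast (c : ℕ → Bool) :
    (∑ j ∈ Finset.range 64, (if c j = true then (1 : ℝ) else 0)) = (SF c : ℝ) := by
  rw [SF]; push_cast
  refine Finset.sum_congr rfl fun j _ => ?_
  split_ifs <;> simp

/-- Face-`1` version: the cast of `ST a c`. [this work] -/
theorem sum_top_cast (c : ℕ → Bool) (a : ℕ) :
    (∑ j ∈ Finset.range 64, (if j.testBit a = true then (if c j = true then (1 : ℝ) else 0) else 0)) = (ST a c : ℝ) := by
  rw [ST]; push_cast
  refine Finset.sum_congr rfl fun j _ => ?_
  cases hj : j.testBit a <;> cases hc : c j <;> simp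

/-- Face-`0` version: the cast of `SB a c`. [this work] -/
theorem sum_bot_cast (c : ℕ → Bool) (a : ℕ) :
    (∑ j ∈ Finset.range 64, (if j.testBit a = true then 0 else (if c j = true then (1 : ℝ) else 0))) = (SB a c : ℝ) := by
  rw [SB]; push_cast
  refine Finset.sum_congr rfl fun j _ => ?_
  cases hj : j.testBit a <;> cases hc : c j <;> simp

/-- The seven bulk counts: singles `46`, pairs `36`, triple `27` (kernel computation over `j < 64`). [this work] -/
theorem counts_full :
    SF bF = 46 ∧ SF bG = 46 ∧ SF bH = 46 ∧ SF (fun j => bF j && bG j) = 36 ∧ SF (fun j => bF j && bH j) = 36 ∧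
      SF (fun j => bG j && bH j) = 36 ∧ SF (fun j => bF j && bG j && bH j) = 27 := by
  decide

/-- **Kernel identity on the face `x_a = 1`, uniformly in the axis**: `2·32²·S_{FGH} + S_F S_G S_H = 32(S_F S_{GH} + S_G S_{FH} + S_H S_{FG})`,
i.e. `32³·Φ_a(1) = 0`, for all six `a`. [this work] -/
theorem top_identity : ∀ a : Fin 6,
    2 * 1024 * ST a (fun j => bF j && bG j && bH j) + ST a bF * ST a bG * ST a bH =
      32 * (ST a bF * ST a (fun j => bG j && bH j) + ST a bG * ST a (fun j => bF j && bH j) +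
        ST a bH * ST a (fun j => bF j && bG j)) := by
  decide

/-- **Kernel identity on the face `x_a = 0`, uniformly in the axis**: `32³·Φ_a(0) = 156` for all six `a`. [this work] -/
theorem bot_identity : ∀ a : Fin 6,
    2 * 1024 * SB a (fun j => bF j && bG j && bH j) + SB a bF * SB a bG * SB a bH =
      32 * (SB a bF * SB a (fun j => bG j && bH j) + SB a bG * SB a (fun j => bF j && bH j) +
        SB a bH * SB a (fun j => bF j && bG j)) + 156 := by
  decide

/-! ### 5. The values of `E_3`: the bulk, and the two sections along every axis -/

/-- **`E_3(μ_{1/2}; F, G, H) = 71/32768`.** [this work] -/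
theorem sahiE_three_q12 : sahiE (bernoulliWeight q12) 3 ![ind ugF, ind ugG, ind ugH] = 71 / 32768 := by
  rw [sahiE_three]
  simp only [ex_q12, Pi.mul_apply, ind_eq_ite _ _ _ (mem_ugF _), ind_eq_ite _ _ _ (mem_ugG _), ind_eq_ite _ _ _ (mem_ugH _),
    SahiCoordinateTwoThirdsFalse.ite_mul_ite, sum_full_cast]
  obtain ⟨h1, h2, h3, h4, h5, h6, h7⟩ := counts_full
  have e : (2 * 4096 * (SF (fun j => bF j && bG j && bH j) : ℝ) + (SF bF : ℝ) * SF bG * SF bH -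
      64 * ((SF bF : ℝ) * SF (fun j => bG j && bH j) + (SF bG : ℝ) * SF (fun j => bF j && bH j) +
        (SF bH : ℝ) * SF (fun j => bF j && bG j))) = 568 := by
    rw [h1, h2, h3, h4, h5, h6, h7]; norm_num
  linear_combination e / 262144

/-- **The `1`-sections have `E_3 = 0` along every axis** (`Φ_a(1) = 0`). [this work] -/
theorem sahiE_three_top (a : Fin 6) : sahiE (bernoulliWeight (update q12 a 1)) 3 ![ind ugF, ind ugG, ind ugH] = 0 := by
  rw [sahiE_three]
  simp only [ex_top, Pi.mul_apply, ind_eq_ite _ _ _ (mem_ugF _), ind_eq_ite _ _ _ (mem_ugG _), ind_eq_ite _ _ _ (mem_ugH _),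
    SahiCoordinateTwoThirdsFalse.ite_mul_ite, sum_top_cast]
  have h' : (2 * 1024 * (ST a (fun j => bF j && bG j && bH j) : ℝ) + (ST a bF : ℝ) * ST a bG * ST a bH =
      32 * ((ST a bF : ℝ) * ST a (fun j => bG j && bH j) + (ST a bG : ℝ) * ST a (fun j => bF j && bH j) +
        (ST a bH : ℝ) * ST a (fun j => bF j && bG j))) := by
    exact_mod_cast top_identity a
  linear_combination h' / 32768

/-- **The `0`-sections have `E_3 = 39/8192 = 156/32768` along every axis** (`Φ_a(0)`). [this work] -/
theorem sahiE_three_bot (a : Fin 6) :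
    sahiE (bernoulliWeight (update q12 a 0)) 3 ![ind ugF, ind ugG, ind ugH] = 39 / 8192 := by
  rw [sahiE_three]
  simp only [ex_bot, Pi.mul_apply, ind_eq_ite _ _ _ (mem_ugF _), ind_eq_ite _ _ _ (mem_ugG _), ind_eq_ite _ _ _ (mem_ugH _),
    SahiCoordinateTwoThirdsFalse.ite_mul_ite, sum_bot_cast]
  have h' : (2 * 1024 * (SB a (fun j => bF j && bG j && bH j) : ℝ) + (SB a bF : ℝ) * SB a bG * SB a bH =
      32 * ((SB a bF : ℝ) * SB a (fun j => bG j && bH j) + (SB a bG : ℝ) * SB a (fun j => bF j && bH j) +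
        (SB a bH : ℝ) * SB a (fun j => bF j && bG j)) + 156) := by
    exact_mod_cast bot_identity a
  linear_combination h' / 32768

/-! ### 6. The fibre cubic at `1`, `0` and `1/2`, and the refutation -/

/-- Bridge to the tree's fibre cubic: `E_3(μ_{q[a ↦ s]}; F,G,H) = Φ_a(s)`. [this work] -/
theorem sahiE_three_update_eq' (a : Fin 6) (s : unitInterval) :
    sahiE (bernoulliWeight (update q12 a s)) 3 ![ind ugF, ind ugG, ind ugH] =
      cubicE3 q12 a (ind ugF) (ind ugG) (ind ugH) (s : ℝ) := by
  convert sahiE_three_update_eq q12 a s (ind ugF) (ind ugG) (ind ugH)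

/-- `Φ_a(1) = 0`, `Φ_a(0) = 39/8192`, `Φ_a(1/2) = 71/32768` for every axis `a`. [this work] -/
theorem cubicE3_values (a : Fin 6) :
    cubicE3 q12 a (ind ugF) (ind ugG) (ind ugH) 1 = 0 ∧
      cubicE3 q12 a (ind ugF) (ind ugG) (ind ugH) 0 = 39 / 8192 ∧
      cubicE3 q12 a (ind ugF) (ind ugG) (ind ugH) (1 / 2) = 71 / 32768 := by
  refine ⟨?_, ?_, ?_⟩
  · rw [← Set.Icc.coe_one, ← sahiE_three_update_eq' a 1, sahiE_three_top]
  · rw [← Set.Icc.coe_zero, ← sahiE_three_update_eq' a 0, sahiE_three_bot]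
  · rw [← coe_q12 a, ← sahiE_three_update_eq' a (q12 a), update_eq_self, sahiE_three_q12]

/-- **Every axis has NEGATIVE sectional chord defect at the uniform measure**: `½Φ_a(1) + ½Φ_a(0) = 78/32768 > 71/32768 = Φ_a(½)`. [this work] -/
theorem chord_gt (a : Fin 6) :
    cubicE3 q12 a (ind ugF) (ind ugG) (ind ugH) ((half : unitInterval) : ℝ) <
      ((half : unitInterval) : ℝ) * cubicE3 q12 a (ind ugF) (ind ugG) (ind ugH) 1 +
        (1 - ((half : unitInterval) : ℝ)) * cubicE3 q12 a (ind ugF) (ind ugG) (ind ugH) 0 := by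
  obtain ⟨h1, h0, hq⟩ := cubicE3_values a
  rw [coe_half, h1, h0, hq]
  norm_num

/-- **`GoodAxisHalf` IS FALSE**: at the uniform measure on six coins the triple `(F, G, H)` with `S` = all coordinates has no axis with
nonnegative sectional chord defect. [this work] -/
theorem not_goodAxisHalf : ¬ GoodAxisHalf := by
  intro h
  obtain ⟨a, -, ha⟩ := h (Fin 6) ugU isUpperSet_ugU Finset.univ Finset.univ_nonempty (fun i => determinedBy_univ' _)
  have e0 : ugU 0 = ugF := rfl
  have e1 : ugU 1 = ugG := rfl
  have e2 : ugU 2 = ugH := rfl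
  rw [e0, e1, e2] at ha
  exact absurd ha (not_le.2 (chord_gt a))

end SahiUniformGoodAxisFalse

end Summit.CriticalPhenomena.PercolationContinuityZ3.Theorems
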